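import Summits.QuantumFields.YangMills.Theorems.BalabanUVNodesN06Thm312313ParLawsQG
import Summits.QuantumFields.YangMills.Theorems.BalabanUVNodesN06Thm312313ParLawsQStar
import Summits.QuantumFields.YangMills.Theorems.BalabanUVNodesN06Thm312313ParLawsQL2Knit
import Literature.MathematicalPhysics.QuantumFieldTheory.Balaban1983to89.Node00.OpsYKnitGuardAdaptersKD
import Literature.MathematicalPhysics.QuantumFieldTheory.Balaban1983to89.Node00.OpsYBondMapOfRecord
import Literature.MathematicalPhysics.QuantumFieldTheory.Balaban1983to89.B9B8KnitLetterProjectionC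
import Literature.MathematicalPhysics.QuantumFieldTheory.Balaban1983to89.B9B8KnitLetterGpDecay

/-!
# BalabanUVNodes ∕ N06 ([B9], `Dag.B9_main`) — CASCADE-K «KE» INPUTS: SEVEN DISPLAYED KNIT LAWS OF THE STAGE-11 CERTIFICATE AT THE RECORD («KE₂» ✓
# `…N06AtOpsYSectEStKnitRecordKE2`) IN THEIR OWN BINDER TEXTS, FROM THE CERTIFICATE's OWN BINDERS — `hsymT hsymRT hqK hqsK hqsL2K hqL2K hC1TK` folded by ONE
# named-argument application each (the n06-l tranche of «KE₃»; `h46K` = `…N06Eq346KnitLegAtPinsR.h46K_knit_of_pinsR`)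

T. Bałaban, *Propagators for lattice gauge theories in a background field*, Commun. Math. Phys. **99** (1985) 389–434 [`Balaban1985BackgroundPropagators`], (3.13)–(3.16)
pp.392–393, (3.19) p.393, (3.24)–(3.25) p.394, (3.35)–(3.36) p.396, (3.115) p.418, (3.132) p.422, (3.134) p.422, Thm 3.13 p.426; *Averaging operations for lattice gauge theories*,
Commun. Math. Phys. **98** (1985) 17–51 [`Balaban1985Averaging`], Prop. 2 (52)–(53) p.26; *Propagators … II*, Commun. Math. Phys. **96** (1984) 223–250 [`Balaban1984PropagatorsII`],
Lemma 2.1 (2.60) p.234.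

Track A of `YM-PLAN.md` (cell `pub-ymgap`, HUMAN RULING D-0062), node **N06**; bundle F7 rows 20–21, seat `pub-ymgap-dag-n06-l` (g40).  WHY.  After «KE₂» (dag-n06-d g26: the
three def-Y adapters folded, ⚑ LOCATED-30 resolved at the record) the certificate still DISPLAYS the knit laws `hsymT hsymRT hidsK hqsK hqsL2K hqL2K hqK hC1TK h46K hD2P`.  Seven
of them are by-name consequences of theorems of this seat (g37–g40) and def-Y's letter lemmas, from «KE₂»'s OWN binders: the regime bridge `hRP1` (print's member class (3.35) at
`c35Y`), `hGR` (`R₁` SU(N)-valued), the x-free knit numerics `hαK hαK3 hαK2 hαK4 hexpK hαQK hKplK ha12 ha12K hM12`, the pins `hQco12 hQsco12 hC1co12 hblk12 hblkZ12`, the bond map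
`hbI`.  THIS FILE states each law in «KE₂»'s binder text VERBATIM (the constants `BQp BQs BQL` instantiated by explicit closed terms, the rate `ε := δ12₃` in the (2.60) transfer)
so that «KE₃» is one `exact …KE2 (hsymT := …) (hsymRT := …) (hqK := …) …`.  NO `hN : N ≤ 25` anywhere: `hsymT ∕ hsymRT` read the knit legs in the AMBIENT group `U(N)`
(`symm0_parKnitY` ∕ `RY_parKnitY_isSymmTr` at `G := U(N)`, legs unitary by [5] Prop. 2 at the retraction — `…ParLawsQG.hparK_knit_of_pinsR`), not in `SU(N)` (which would need
the `AvgClosed` range lemma).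
WHAT IS PROVED (0 `def`, 0 `sorry`).  §1 ★★ `hsymT_knit_of_pinsR`, ★★ `hsymRT_knit_of_pinsR` (from `hGR hRP1 hαK hαK3 hαK2 hKplK ha12K`); §2 ★ `BQpK_nonneg`, ★★★ `hqK_knit_of_pinsR`
(+ `hδ3 : 0 < δ12₃`, `hM12 hM12q`, `hαQK`); §3 ★ `BQsK_nonneg`, ★★★ `hqsK_knit_of_pinsR` (+ `hδQs3`); §4 ★★★ `hqsL2K_knit_of_pinsR`, ★★★ `hqL2K_knit_of_pinsR` (the (2.60) rate
`ε := δ12₃`, so «KE₂»'s numerics suffice: `hM12q : 2·log L ≤ δ12₃(2L²−1)M12`); §5 ★★★ `hC1TK_knitRecord_of_pinsR` — «KE₂»'s `hC1TK` at `𝔯 := resYOfRecordPK` with its guarded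
`hΔ2` supplied by def-Y's ✓ `hΔ2_knitRecord_of_RP1` (inputs `hαK4 hexpK ha12 ha12K`).
HONEST FRAMING.  Packaging over landed modules (✓ParLawsQ{Row,Star,L2Knit,G}, def-Y ✓`OpsYKnitGuardAdaptersKD`, J-B ∕ n06-l knit-letter lemmas); nothing of [B9]'s estimates newly
asserted; COUNT-NEUTRAL; N06 NOT discharged; one finite 𝕋⁴ programme at fixed `ε` — NOT continuum, NOT OS, NOT the mass gap ∕ Clay.  No `instance`, no `notation`.  NEW file.
RELATED, NOT DUPLICATED (searched 2026-08-30: `rg -l -w "N06KnitLawsAtRecordKE|hsymT_knit_of_pinsR|hqK_knit_of_pinsR|hqsK_knit_of_pinsR|hqsL2K_knit_of_pinsR|hC1TK_knitRecord_of_pinsR"` = ∅).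
-/

noncomputable section

namespace Summit.QuantumFields.YangMills.BalabanUVNodes.N06KnitLawsAtRecordKE

open scoped Matrix.Norms.L2Operator
open Literature.MathematicalPhysics.QuantumFieldTheory.Balaban1983to89
open Literature.MathematicalPhysics.QuantumFieldTheory.Balaban1983to89.Node00
open Literature.MathematicalPhysics.QuantumFieldTheory.Balaban1983to89.B6KLevelCensusIndexV1 (KIdx kGeo)
open Literature.MathematicalPhysics.QuantumFieldTheory.Balaban1983to89.B6Ineq2142KLevelV1 (lvl β)
open Literature.MathematicalPhysics.QuantumFieldTheory.Balaban1983to89.B6GlobalChartV1 (blkV1)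
open Literature.MathematicalPhysics.QuantumFieldTheory.Balaban1983to89.B6Geom246MultiLevelTorus (geomT)
open Literature.MathematicalPhysics.QuantumFieldTheory.Balaban1983to89.B9PinMembersKLevelV1 (MemberY geo9Y bg9Y)
open Literature.MathematicalPhysics.QuantumFieldTheory.Balaban1983to89.B9BackgroundsKLevelV1P (bg9KP bg9YP)
open Literature.MathematicalPhysics.QuantumFieldTheory.Balaban1983to89.B9BackgroundsKLevelV1R (RegFamY bg9YR MemOfFam mem_of_reg335R)
open Literature.MathematicalPhysics.QuantumFieldTheory.Balaban1983to89.B9PinGeometryKLevelV1 (c35Y c35Y_eq)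
open Literature.MathematicalPhysics.QuantumFieldTheory.Balaban1983to89.B7Prop2SpecialUnitary (specialUnitaryUnits specialUnitaryUnits_le_unitaryUnits)
open Literature.MathematicalPhysics.QuantumFieldTheory.Balaban1983to89.B7Prop2Explicit (C0 c2')
open Literature.MathematicalPhysics.QuantumFieldTheory.Balaban1983to89.B9C2FormBoxRegimeY (Kpl)
open Literature.MathematicalPhysics.QuantumFieldTheory.Balaban1983to89.B9CoReadingCoords (XBK blkBK)
open Literature.MathematicalPhysics.QuantumFieldTheory.Balaban1983to89.B9CoReadingCoordsH (XHK blkHK)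
open Literature.MathematicalPhysics.QuantumFieldTheory.Balaban1983to89.B9CoReadingCoordsTranspose (TrIdx trBasis)
open Literature.MathematicalPhysics.QuantumFieldTheory.Balaban1983to89.B9Thm34Ext (toB6)
open Literature.MathematicalPhysics.QuantumFieldTheory.Balaban1983to89.B9Thm312Whole (Ops cNorm)
open Literature.MathematicalPhysics.QuantumFieldTheory.Balaban1983to89.B9SectDL2Decay (BlockBd)
open Literature.MathematicalPhysics.QuantumFieldTheory.Balaban1983to89.B9SectDSup (weightNorm)
open Literature.MathematicalPhysics.QuantumFieldTheory.Balaban1983to89.B11SectG (HasMaj BlockNorm)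
open Literature.MathematicalPhysics.QuantumFieldTheory.Balaban1983to89.B9LettersHZAtOne (plateau_pos)
open Literature.MathematicalPhysics.QuantumFieldTheory.Balaban1983to89.B9GeoLemma21KLevelV1 (geo9Y_len_pos)
open Literature.MathematicalPhysics.QuantumFieldTheory.Balaban1983to89.B9Thm37Glue (IsTransposePair)
open Literature.MathematicalPhysics.QuantumFieldTheory.Balaban1983to89.B9Thm311ReadingCoords (IsSymmTr)
open Literature.MathematicalPhysics.QuantumFieldTheory.Balaban1983to89.B9B8AveragingJunction (parKnitY)
open Literature.MathematicalPhysics.QuantumFieldTheory.Balaban1983to89.B9B8KnitLetterGpDecay (symm0_parKnitY)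
open Literature.MathematicalPhysics.QuantumFieldTheory.Balaban1983to89.B9B8KnitLetterProjectionC (RY_parKnitY_isSymmTr)
open Literature.MathematicalPhysics.QuantumFieldTheory.Balaban1983to89.B9Thm311AdjointPairs (GpY_isSymmTr)
open Literature.MathematicalPhysics.QuantumFieldTheory.Balaban1983to89.B9Eq316AveragingTransposeZd (alphaQ)
open Literature.MathematicalPhysics.QuantumFieldTheory.Balaban1983to89.B9Eq3115KnitLetterYOnto (kCol kCol_nonneg)
open Literature.MathematicalPhysics.QuantumFieldTheory.Balaban1983to89.Node00.OpsYOps312OfRecordPar (QcoKHq QscoKHq C1coKq)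
open Literature.MathematicalPhysics.QuantumFieldTheory.Balaban1983to89.Node00.OpsYQLetter (qKnitOfRecord qsKnitOfRecord)
open Literature.MathematicalPhysics.QuantumFieldTheory.Balaban1983to89.Node00.OpsYBondMapOfRecord (bIYOfRecord lawsY_of_eq)
open Summit.QuantumFields.YangMills.BalabanUVNodes.N06Thm312313ParLawsQG (hparK_knit_of_pinsR hC1T_knit_of_pinsG_resK)
open Summit.QuantumFields.YangMills.BalabanUVNodes.N06Thm312313ParLawsQRow (hqK_knit_of_laws)
open Summit.QuantumFields.YangMills.BalabanUVNodes.N06Thm312313ParLawsQStar (hqsK_knit_of_laws)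
open Summit.QuantumFields.YangMills.BalabanUVNodes.N06Thm312313ParLawsQL2Knit (hqsL2K_knit_of_laws hqL2K_knit_of_laws BQL_knit_nonneg)

variable {N : ℕ} [NeZero N] [Nonempty (Fin N)] (θ : Stage3Params) (Mstar : ℕ) [∀ x : MemberY θ.d₆ θ.ℓ₆ θ.hd' θ.hL' θ.b₀ θ.b₁ Mstar, Fintype (geo9Y x).Site]
  {R₁ R₂ : RegFamY θ.d₆ θ.ℓ₆ θ.hd' θ.hL' θ.b₀ θ.b₁ Mstar (Matrix (Fin N) (Fin N) ℂ)} {c : ℝ}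

/-! ## §1 `hsymT` ∕ `hsymRT`: `G′(U; parKnitY)` and `R(U; parKnitY, G′)` symmetric — knit legs read in `U(N)`, NO `N`-cap -/

omit [NeZero N] [∀ x : MemberY θ.d₆ θ.ℓ₆ θ.hd' θ.hL' θ.b₀ θ.b₁ Mstar, Fintype (geo9Y x).Site] in
/-- ★★ **«KE₂»'s `hsymT` FROM ITS OWN BINDERS**: on the class, `U` is SU(N)-valued (`hGR`) and the knit legs are `U(N)`-valued ([5] Prop. 2 at the retraction, `hRP1` +
x-free numerics), so `Δ′_a(U; parKnitY)` is symmetric (`symm0_parKnitY` at `G := U(N)`) and so is its inverse `G′(U; parKnitY)` (`GpY_isSymmTr`).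
[cite: Balaban1985BackgroundPropagators, (3.19) p.393, (3.24) p.394, (3.35) p.396; Balaban1985Averaging, Prop. 2 (52)–(53) p.26] -/
theorem hsymT_knit_of_pinsR (hGR : MemOfFam (specialUnitaryUnits (Fin N)) R₁)
    (hRP1 : ∀ (x : MemberY θ.d₆ θ.ℓ₆ θ.hd' θ.hL' θ.b₀ θ.b₁ Mstar) (α₀ : ℝ) (U : (bg9YR (Matrix (Fin N) (Fin N) ℂ) (specialUnitaryUnits (Fin N)) R₁ R₂ x).Cfg),
      (bg9YR (Matrix (Fin N) (Fin N) ℂ) (specialUnitaryUnits (Fin N)) R₁ R₂ x).Reg335 c α₀ U →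
        0 ≤ α₀ ∧ (bg9YP (Matrix (Fin N) (Fin N) ℂ) (specialUnitaryUnits (Fin N)) x).Reg335 c35Y α₀ U)
    {M12 a12 α₀K aK : ℝ} (hαK : 0 < α₀K) (hαK3 : C0 (θ.d₆ + 1) * α₀K ≤ 1 / 3) (hαK2 : 2 * α₀K ≤ c2' (θ.d₆ + 1) (θ.ℓ₆ + 1))
    (hKplK : ∀ (i : KIdx θ.d₆ θ.ℓ₆ θ.hd' θ.hL' θ.b₀ θ.b₁) (a : ℝ), 0 ≤ a → a ≤ aK → Kpl i a * (kGeo i).L ^ 4 < α₀K) (ha12K : a12 ≤ aK) :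
    ∀ x : MemberY θ.d₆ θ.ℓ₆ θ.hd' θ.hL' θ.b₀ θ.b₁ Mstar, M12 ≤ (geo9Y x).M → ∀ α₀ : ℝ, 0 < α₀ → (geo9Y x).M * α₀ ≤ a12 → ∀ U : (bg9YR (Matrix (Fin N) (Fin N) ℂ) (specialUnitaryUnits (Fin N)) R₁ R₂ x).Cfg, (bg9YR (Matrix (Fin N) (Fin N) ℂ) (specialUnitaryUnits (Fin N)) R₁ R₂ x).Reg335 c α₀ U → IsSymmTr (fun _ => (1 : ℝ)) (Node00.GpY x.toKIdx (parKnitY x.toKIdx) U) := by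
  intro x hM α₀ hα ha U hU
  have hUU : ∀ μ z, U μ z ∈ B7Prop2Explicit.unitaryUnits (Matrix (Fin N) (Fin N) ℂ) := fun μ z => specialUnitaryUnits_le_unitaryUnits (mem_of_reg335R hGR x hU μ z)
  have hpar := hparK_knit_of_pinsR θ Mstar hRP1 (M12 := M12) hαK hαK3 hαK2 (fun x a h0 h => hKplK x.toKIdx a h0 (h.trans ha12K)) x hM α₀ hα ha U hU
  exact GpY_isSymmTr x.toKIdx (parKnitY x.toKIdx) U (symm0_parKnitY x.toKIdx le_rfl hUU hpar)

omit [NeZero N] [∀ x : MemberY θ.d₆ θ.ℓ₆ θ.hd' θ.hL' θ.b₀ θ.b₁ Mstar, Fintype (geo9Y x).Site] in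
/-- ★★ **«KE₂»'s `hsymRT` FROM ITS OWN BINDERS**: `R(U; parKnitY, G′)` (3.25) is symmetric on the class (`RY_parKnitY_isSymmTr` at `G := U(N)`, legs unitary as in `hsymT`).
[cite: Balaban1985BackgroundPropagators, (3.25) p.394, (3.19) p.393, (3.35) p.396; Balaban1985Averaging, Prop. 2 (52)–(53) p.26] -/
theorem hsymRT_knit_of_pinsR (hGR : MemOfFam (specialUnitaryUnits (Fin N)) R₁)
    (hRP1 : ∀ (x : MemberY θ.d₆ θ.ℓ₆ θ.hd' θ.hL' θ.b₀ θ.b₁ Mstar) (α₀ : ℝ) (U : (bg9YR (Matrix (Fin N) (Fin N) ℂ) (specialUnitaryUnits (Fin N)) R₁ R₂ x).Cfg),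
      (bg9YR (Matrix (Fin N) (Fin N) ℂ) (specialUnitaryUnits (Fin N)) R₁ R₂ x).Reg335 c α₀ U →
        0 ≤ α₀ ∧ (bg9YP (Matrix (Fin N) (Fin N) ℂ) (specialUnitaryUnits (Fin N)) x).Reg335 c35Y α₀ U)
    {M12 a12 α₀K aK : ℝ} (hαK : 0 < α₀K) (hαK3 : C0 (θ.d₆ + 1) * α₀K ≤ 1 / 3) (hαK2 : 2 * α₀K ≤ c2' (θ.d₆ + 1) (θ.ℓ₆ + 1))
    (hKplK : ∀ (i : KIdx θ.d₆ θ.ℓ₆ θ.hd' θ.hL' θ.b₀ θ.b₁) (a : ℝ), 0 ≤ a → a ≤ aK → Kpl i a * (kGeo i).L ^ 4 < α₀K) (ha12K : a12 ≤ aK) :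
    ∀ x : MemberY θ.d₆ θ.ℓ₆ θ.hd' θ.hL' θ.b₀ θ.b₁ Mstar, M12 ≤ (geo9Y x).M → ∀ α₀ : ℝ, 0 < α₀ → (geo9Y x).M * α₀ ≤ a12 → ∀ U : (bg9YR (Matrix (Fin N) (Fin N) ℂ) (specialUnitaryUnits (Fin N)) R₁ R₂ x).Cfg, (bg9YR (Matrix (Fin N) (Fin N) ℂ) (specialUnitaryUnits (Fin N)) R₁ R₂ x).Reg335 c α₀ U → IsSymmTr (fun _ => (1 : ℝ)) (Node00.RY x.toKIdx (parKnitY x.toKIdx) (Node00.GpY x.toKIdx (parKnitY x.toKIdx)) U) := by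
  intro x hM α₀ hα ha U hU
  have hUU : ∀ μ z, U μ z ∈ B7Prop2Explicit.unitaryUnits (Matrix (Fin N) (Fin N) ℂ) := fun μ z => specialUnitaryUnits_le_unitaryUnits (mem_of_reg335R hGR x hU μ z)
  have hpar := hparK_knit_of_pinsR θ Mstar hRP1 (M12 := M12) hαK hαK3 hαK2 (fun x a h0 h => hKplK x.toKIdx a h0 (h.trans ha12K)) x hM α₀ hα ha U hU
  exact RY_parKnitY_isSymmTr x.toKIdx le_rfl hUU hpar

/-! ## §2 `hqK`: the (3.15) sup-exp block letters of `Q` at the knit letter, `BQp` instantiated -/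

omit [NeZero N] [Nonempty (Fin N)] [∀ x : MemberY θ.d₆ θ.ℓ₆ θ.hd' θ.hL' θ.b₀ θ.b₁ Mstar, Fintype (geo9Y x).Site] in
/-- ★ «KE₂»'s `hBQp` at the instantiated constant `BQp := (1 + 2(d+1)K_col α₀K)·L²·e^{2δ12₃(ℓ+4)}`. [cite: Balaban1985BackgroundPropagators, (3.15) p.393, bookkeeping] -/
theorem BQpK_nonneg {α₀K δ12₃ : ℝ} (hα : 0 ≤ α₀K) :
    0 ≤ (1 + kCol (θ.d₆ + 1) (θ.ℓ₆ + 1) * α₀K * (2 * ((θ.d₆ : ℝ) + 1))) * (((θ.ℓ₆ + 1 : ℕ) : ℝ)) ^ 2 * Real.exp (2 * δ12₃ * ((θ.ℓ₆ : ℝ) + 4)) := by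
  have := kCol_nonneg (θ.d₆ + 1) (θ.ℓ₆ + 1)
  positivity

omit [NeZero N] in
/-- ★★★ **«KE₂»'s `hqK` FROM ITS OWN BINDERS** at `BQp := (1 + 2(d+1)K_col α₀K)·L²·e^{2δ12₃(ℓ+4)}`: the pin `hQco12`, the block maps `hblk12 hblkZ12`, the bond map of record `hbI`, the
regime bridge `hRP1`, the numerics `hM12 hδ3 hM12q hαK hαQK hKplK ha12K` — `…ParLawsQRow.hqK_knit_of_laws`.
[cite: Balaban1985BackgroundPropagators, (3.15) p.393, (3.115) p.418, (3.35) p.396; Balaban1984PropagatorsII, Lemma 2.1 (2.60) p.234; Balaban1985Averaging, Prop. 2 p.26] -/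
theorem hqK_knit_of_pinsR
    {W12 : MemberY θ.d₆ θ.ℓ₆ θ.hd' θ.hL' θ.b₀ θ.b₁ Mstar → Type} [∀ x, Fintype (W12 x)]
    (𝔬12 : ∀ x : MemberY θ.d₆ θ.ℓ₆ θ.hd' θ.hL' θ.b₀ θ.b₁ Mstar, Ops (geo9Y x) (bg9YR (Matrix (Fin N) (Fin N) ℂ) (specialUnitaryUnits (Fin N)) R₁ R₂ x) (XBK (TrIdx N) x.toKIdx) (XBK (TrIdx N) x.toKIdx) (XHK (TrIdx N) x.toKIdx) (W12 x))
    {bI : ∀ x : MemberY θ.d₆ θ.ℓ₆ θ.hd' θ.hL' θ.b₀ θ.b₁ Mstar, FBondY x.toKIdx → IBondY x.toKIdx} (hbI : bI = bIYOfRecord θ Mstar)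
    (H : MemberY θ.d₆ θ.ℓ₆ θ.hd' θ.hL' θ.b₀ θ.b₁ Mstar → Prop)
    (hblk12 : ∀ x : MemberY θ.d₆ θ.ℓ₆ θ.hd' θ.hL' θ.b₀ θ.b₁ Mstar, (𝔬12 x).blk = blkBK x.toKIdx (bI x)) (hblkZ12 : ∀ x : MemberY θ.d₆ θ.ℓ₆ θ.hd' θ.hL' θ.b₀ θ.b₁ Mstar, (𝔬12 x).blkZ = blkHK x.toKIdx)
    (hQco12 : ∀ (x : MemberY θ.d₆ θ.ℓ₆ θ.hd' θ.hL' θ.b₀ θ.b₁ Mstar) (U : (bg9YR (Matrix (Fin N) (Fin N) ℂ) (specialUnitaryUnits (Fin N)) R₁ R₂ x).Cfg),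
      (𝔬12 x).Q U = QcoKHq x.toKIdx (trBasis N) (bg9YR (Matrix (Fin N) (Fin N) ℂ) (specialUnitaryUnits (Fin N)) R₁ R₂ x) (fun U => U) (qKnitOfRecord N θ x.toKIdx) U)
    (hRP1 : ∀ (x : MemberY θ.d₆ θ.ℓ₆ θ.hd' θ.hL' θ.b₀ θ.b₁ Mstar) (α₀ : ℝ) (U : (bg9YR (Matrix (Fin N) (Fin N) ℂ) (specialUnitaryUnits (Fin N)) R₁ R₂ x).Cfg),
      (bg9YR (Matrix (Fin N) (Fin N) ℂ) (specialUnitaryUnits (Fin N)) R₁ R₂ x).Reg335 c α₀ U →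
        0 ≤ α₀ ∧ (bg9YP (Matrix (Fin N) (Fin N) ℂ) (specialUnitaryUnits (Fin N)) x).Reg335 c35Y α₀ U)
    {M12 a12 δ12₃ α₀K aK : ℝ} (hM12 : 0 < M12) (hδ3 : 0 < δ12₃)
    (hM12q : (2 : ℝ) * Real.log (((θ.ℓ₆ + 1 : ℕ) : ℝ)) ≤ δ12₃ * (2 * ((θ.ℓ₆ : ℝ) + 1) ^ 2 - 1) * M12)
    (hαK : 0 < α₀K) (hαQK : α₀K ≤ alphaQ (θ.d₆ + 1) (θ.ℓ₆ + 1))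
    (hKplK : ∀ (i : KIdx θ.d₆ θ.ℓ₆ θ.hd' θ.hL' θ.b₀ θ.b₁) (a : ℝ), 0 ≤ a → a ≤ aK → Kpl i a * (kGeo i).L ^ 4 < α₀K) (ha12K : a12 ≤ aK) :
    ∀ x : MemberY θ.d₆ θ.ℓ₆ θ.hd' θ.hL' θ.b₀ θ.b₁ Mstar, M12 ≤ (geo9Y x).M → ∀ α₀ : ℝ, 0 < α₀ → (geo9Y x).M * α₀ ≤ a12 → ∀ U : (bg9YR (Matrix (Fin N) (Fin N) ℂ) (specialUnitaryUnits (Fin N)) R₁ R₂ x).Cfg, (bg9YR (Matrix (Fin N) (Fin N) ℂ) (specialUnitaryUnits (Fin N)) R₁ R₂ x).Reg335 c α₀ U → ∀ p' : ℕ, p' ≤ 2 → HasMaj (cNorm 1 (H x) (𝔬12 x).blk (fun y => (geo9Y_len_pos x y).le) p') (cNorm 1 (H x) (𝔬12 x).blkZ (fun y => (geo9Y_len_pos x y).le) p') ((𝔬12 x).Q U) (fun a a' => ((1 + kCol (θ.d₆ + 1) (θ.ℓ₆ + 1) * α₀K * (2 * ((θ.d₆ : ℝ) + 1))) * (((θ.ℓ₆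 + 1 : ℕ) : ℝ)) ^ 2 * Real.exp (2 * δ12₃ * ((θ.ℓ₆ : ℝ) + 4))) * Real.exp (-(δ12₃ * (geo9Y x).dist a a'))) :=
  hqK_knit_of_laws θ Mstar 𝔬12 bI (lawsY_of_eq hbI).2.2.1 H hblk12 hblkZ12 hQco12 hM12 hδ3 hM12q c35Y_eq.le (fun x α₀ U hU => (hRP1 x α₀ U hU).2.1) hαK hαQK
    (fun x a h0 h => hKplK x.toKIdx a h0 (h.trans ha12K))

/-! ## §3 `hqsK`: the weighted sup-exp block letter of `Q⋆` at the knit adjoint, `BQs` instantiated -/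

omit [NeZero N] [Nonempty (Fin N)] [∀ x : MemberY θ.d₆ θ.ℓ₆ θ.hd' θ.hL' θ.b₀ θ.b₁ Mstar, Fintype (geo9Y x).Site] in
/-- ★ «KE₂»'s `hBQs` at the instantiated constant `BQs := N⁴(1 + K_col α₀K)·e^{δQs(ℓ+4)}`. [cite: Balaban1985BackgroundPropagators, (3.16) p.393, bookkeeping] -/
theorem BQsK_nonneg {α₀K δQs : ℝ} (hα : 0 ≤ α₀K) :
    0 ≤ (N : ℝ) ^ 4 * (1 + kCol (θ.d₆ + 1) (θ.ℓ₆ + 1) * α₀K) * Real.exp (δQs * ((θ.ℓ₆ : ℝ) + 4)) := by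
  have := kCol_nonneg (θ.d₆ + 1) (θ.ℓ₆ + 1)
  positivity

omit [NeZero N] in
/-- ★★★ **«KE₂»'s `hqsK` FROM ITS OWN BINDERS** at `BQs := N⁴(1 + K_col α₀K)·e^{δQs(ℓ+4)}` and the displayed rate `δQs` (`hδQs3 : δ12₃ + 1 ≤ δQs`, `hδ3 : 0 < δ12₃`):
`…ParLawsQStar.hqsK_knit_of_laws`. [cite: Balaban1985BackgroundPropagators, (3.16) p.393, Thm 3.13 p.426, (3.115) p.418, (3.35) p.396; Balaban1985Averaging, Prop. 2 p.26] -/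
theorem hqsK_knit_of_pinsR
    {W12 : MemberY θ.d₆ θ.ℓ₆ θ.hd' θ.hL' θ.b₀ θ.b₁ Mstar → Type} [∀ x, Fintype (W12 x)]
    (𝔬12 : ∀ x : MemberY θ.d₆ θ.ℓ₆ θ.hd' θ.hL' θ.b₀ θ.b₁ Mstar, Ops (geo9Y x) (bg9YR (Matrix (Fin N) (Fin N) ℂ) (specialUnitaryUnits (Fin N)) R₁ R₂ x) (XBK (TrIdx N) x.toKIdx) (XBK (TrIdx N) x.toKIdx) (XHK (TrIdx N) x.toKIdx) (W12 x))
    {bI : ∀ x : MemberY θ.d₆ θ.ℓ₆ θ.hd' θ.hL' θ.b₀ θ.b₁ Mstar, FBondY x.toKIdx → IBondY x.toKIdx} (hbI : bI = bIYOfRecord θ Mstar)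
    (H : MemberY θ.d₆ θ.ℓ₆ θ.hd' θ.hL' θ.b₀ θ.b₁ Mstar → Prop)
    (hblk12 : ∀ x : MemberY θ.d₆ θ.ℓ₆ θ.hd' θ.hL' θ.b₀ θ.b₁ Mstar, (𝔬12 x).blk = blkBK x.toKIdx (bI x)) (hblkZ12 : ∀ x : MemberY θ.d₆ θ.ℓ₆ θ.hd' θ.hL' θ.b₀ θ.b₁ Mstar, (𝔬12 x).blkZ = blkHK x.toKIdx)
    (hQsco12 : ∀ (x : MemberY θ.d₆ θ.ℓ₆ θ.hd' θ.hL' θ.b₀ θ.b₁ Mstar) (U : (bg9YR (Matrix (Fin N) (Fin N) ℂ) (specialUnitaryUnits (Fin N)) R₁ R₂ x).Cfg),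
      (𝔬12 x).Qstar U = QscoKHq x.toKIdx (trBasis N) (bg9YR (Matrix (Fin N) (Fin N) ℂ) (specialUnitaryUnits (Fin N)) R₁ R₂ x) (fun U => U) (qsKnitOfRecord N θ x.toKIdx) U)
    (hRP1 : ∀ (x : MemberY θ.d₆ θ.ℓ₆ θ.hd' θ.hL' θ.b₀ θ.b₁ Mstar) (α₀ : ℝ) (U : (bg9YR (Matrix (Fin N) (Fin N) ℂ) (specialUnitaryUnits (Fin N)) R₁ R₂ x).Cfg),
      (bg9YR (Matrix (Fin N) (Fin N) ℂ) (specialUnitaryUnits (Fin N)) R₁ R₂ x).Reg335 c α₀ U →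
        0 ≤ α₀ ∧ (bg9YP (Matrix (Fin N) (Fin N) ℂ) (specialUnitaryUnits (Fin N)) x).Reg335 c35Y α₀ U)
    {M12 a12 δ12₃ δQs α₀K aK : ℝ} (hM12 : 0 < M12) (hδ3 : 0 < δ12₃) (hδQs3 : δ12₃ + 1 ≤ δQs)
    (hαK : 0 < α₀K) (hαQK : α₀K ≤ alphaQ (θ.d₆ + 1) (θ.ℓ₆ + 1))
    (hKplK : ∀ (i : KIdx θ.d₆ θ.ℓ₆ θ.hd' θ.hL' θ.b₀ θ.b₁) (a : ℝ), 0 ≤ a → a ≤ aK → Kpl i a * (kGeo i).L ^ 4 < α₀K) (ha12K : a12 ≤ aK) :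
    ∀ x : MemberY θ.d₆ θ.ℓ₆ θ.hd' θ.hL' θ.b₀ θ.b₁ Mstar, M12 ≤ (geo9Y x).M → ∀ α₀ : ℝ, 0 < α₀ → (geo9Y x).M * α₀ ≤ a12 → ∀ U : (bg9YR (Matrix (Fin N) (Fin N) ℂ) (specialUnitaryUnits (Fin N)) R₁ R₂ x).Cfg, (bg9YR (Matrix (Fin N) (Fin N) ℂ) (specialUnitaryUnits (Fin N)) R₁ R₂ x).Reg335 c α₀ U → HasMaj (weightNorm (BlockNorm.ofBlocks (toB6 (geo9Y x) 1 (H x)) (𝔬12 x).blkZ) (fun y => ((((θ.ℓ₆ + 1 : ℕ) : ℝ) ^ (θ.d₆ + 1)) ^ lvl x.hN x.D x.hk y)⁻¹) (fun y => (plateau_pos x.toKIdx y).le)) (cNorm 1 (H x) (𝔬12 x).blk (fun y => (geo9Y_len_pos x y).le) 0) ((𝔬12 x).Qstar U) (fun a a' => ((N : ℝ) ^ 4 * (1 + kCol (θ.d₆ + 1) (θ.ℓ₆ + 1) * α₀K) * Real.exp (δQs * ((θ.ℓ₆ : ℝ) + 4))) * Real.exp (-(δQs * (geo9Y x).dist a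 a'))) :=
  hqsK_knit_of_laws θ Mstar 𝔬12 bI (lawsY_of_eq hbI).2.2.1 H hblk12 hblkZ12 hQsco12 hM12 (le_trans (by positivity) hδQs3) c35Y_eq.le
    (fun x α₀ U hU => (hRP1 x α₀ U hU).2.1) hαK hαQK (fun x a h0 h => hKplK x.toKIdx a h0 (h.trans ha12K))

/-! ## §4 `hqsL2K` ∕ `hqL2K`: the block-`L²` letters of `Q⋆` ∕ `Q`, `BQL` instantiated at the (2.60) rate `ε := δ12₃` -/

omit [NeZero N] [Nonempty (Fin N)] [∀ x : MemberY θ.d₆ θ.ℓ₆ θ.hd' θ.hL' θ.b₀ θ.b₁ Mstar, Fintype (geo9Y x).Site] in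
/-- the (2.60) floor numeric at `ε := δ12₃` from «KE₂»'s `hM12q` (`log L ≤ 2 log L` for `L ≥ 1`). [cite: Balaban1984PropagatorsII, Lemma 2.1 (2.60) p.234, bookkeeping] -/
theorem hM12L_of_hM12q {M12 δ12₃ : ℝ}
    (hM12q : (2 : ℝ) * Real.log (((θ.ℓ₆ + 1 : ℕ) : ℝ)) ≤ δ12₃ * (2 * ((θ.ℓ₆ : ℝ) + 1) ^ 2 - 1) * M12) :
    Real.log (((θ.ℓ₆ + 1 : ℕ) : ℝ)) ≤ δ12₃ * (2 * ((θ.ℓ₆ : ℝ) + 1) ^ 2 - 1) * M12 := by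
  have hlog : 0 ≤ Real.log (((θ.ℓ₆ + 1 : ℕ) : ℝ)) := Real.log_nonneg (by exact_mod_cast Nat.succ_le_succ (Nat.zero_le _))
  linarith

omit [NeZero N] in
/-- ★★★ **«KE₂»'s `hqsL2K` FROM ITS OWN BINDERS** at `BQL := N⁴(1 + 2(d+1)K_col α₀K)·L·e^{(δQs+δ12₃)(ℓ+4)}` (the (2.60) rate `ε := δ12₃`, floor numeric from `hM12q`):
`…ParLawsQL2Knit.hqsL2K_knit_of_laws`. [cite: Balaban1985BackgroundPropagators, Thm 3.13 p.426, (3.16) p.393, (3.115) p.418, (3.35) p.396; Balaban1984PropagatorsII, Lemma 2.1 (2.60) p.234; Balaban1985Averaging, Prop. 2 p.26] -/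
theorem hqsL2K_knit_of_pinsR
    {W12 : MemberY θ.d₆ θ.ℓ₆ θ.hd' θ.hL' θ.b₀ θ.b₁ Mstar → Type} [∀ x, Fintype (W12 x)]
    (𝔬12 : ∀ x : MemberY θ.d₆ θ.ℓ₆ θ.hd' θ.hL' θ.b₀ θ.b₁ Mstar, Ops (geo9Y x) (bg9YR (Matrix (Fin N) (Fin N) ℂ) (specialUnitaryUnits (Fin N)) R₁ R₂ x) (XBK (TrIdx N) x.toKIdx) (XBK (TrIdx N) x.toKIdx) (XHK (TrIdx N) x.toKIdx) (W12 x))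
    {bI : ∀ x : MemberY θ.d₆ θ.ℓ₆ θ.hd' θ.hL' θ.b₀ θ.b₁ Mstar, FBondY x.toKIdx → IBondY x.toKIdx} (hbI : bI = bIYOfRecord θ Mstar)
    (H : MemberY θ.d₆ θ.ℓ₆ θ.hd' θ.hL' θ.b₀ θ.b₁ Mstar → Prop)
    (hblk12 : ∀ x : MemberY θ.d₆ θ.ℓ₆ θ.hd' θ.hL' θ.b₀ θ.b₁ Mstar, (𝔬12 x).blk = blkBK x.toKIdx (bI x)) (hblkZ12 : ∀ x : MemberY θ.d₆ θ.ℓ₆ θ.hd' θ.hL' θ.b₀ θ.b₁ Mstar, (𝔬12 x).blkZ = blkHK x.toKIdx)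
    (hQsco12 : ∀ (x : MemberY θ.d₆ θ.ℓ₆ θ.hd' θ.hL' θ.b₀ θ.b₁ Mstar) (U : (bg9YR (Matrix (Fin N) (Fin N) ℂ) (specialUnitaryUnits (Fin N)) R₁ R₂ x).Cfg),
      (𝔬12 x).Qstar U = QscoKHq x.toKIdx (trBasis N) (bg9YR (Matrix (Fin N) (Fin N) ℂ) (specialUnitaryUnits (Fin N)) R₁ R₂ x) (fun U => U) (qsKnitOfRecord N θ x.toKIdx) U)
    (hRP1 : ∀ (x : MemberY θ.d₆ θ.ℓ₆ θ.hd' θ.hL' θ.b₀ θ.b₁ Mstar) (α₀ : ℝ) (U : (bg9YR (Matrix (Fin N) (Fin N) ℂ) (specialUnitaryUnits (Fin N)) R₁ R₂ x).Cfg),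
      (bg9YR (Matrix (Fin N) (Fin N) ℂ) (specialUnitaryUnits (Fin N)) R₁ R₂ x).Reg335 c α₀ U →
        0 ≤ α₀ ∧ (bg9YP (Matrix (Fin N) (Fin N) ℂ) (specialUnitaryUnits (Fin N)) x).Reg335 c35Y α₀ U)
    {M12 a12 δ12₃ δQs α₀K aK : ℝ} (hM12 : 0 < M12) (hδ3 : 0 < δ12₃) (hδQs3 : δ12₃ + 1 ≤ δQs)
    (hM12q : (2 : ℝ) * Real.log (((θ.ℓ₆ + 1 : ℕ) : ℝ)) ≤ δ12₃ * (2 * ((θ.ℓ₆ : ℝ) + 1) ^ 2 - 1) * M12)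
    (hαK : 0 < α₀K) (hαQK : α₀K ≤ alphaQ (θ.d₆ + 1) (θ.ℓ₆ + 1))
    (hKplK : ∀ (i : KIdx θ.d₆ θ.ℓ₆ θ.hd' θ.hL' θ.b₀ θ.b₁) (a : ℝ), 0 ≤ a → a ≤ aK → Kpl i a * (kGeo i).L ^ 4 < α₀K) (ha12K : a12 ≤ aK) :
    ∀ x : MemberY θ.d₆ θ.ℓ₆ θ.hd' θ.hL' θ.b₀ θ.b₁ Mstar, M12 ≤ (geo9Y x).M → ∀ α₀ : ℝ, 0 < α₀ → (geo9Y x).M * α₀ ≤ a12 → ∀ U : (bg9YR (Matrix (Fin N) (Fin N) ℂ) (specialUnitaryUnits (Fin N)) R₁ R₂ x).Cfg, (bg9YR (Matrix (Fin N) (Fin N) ℂ) (specialUnitaryUnits (Fin N)) R₁ R₂ x).Reg335 c α₀ U → B9SectDL2Decay.BlockBd (g := toB6 (geo9Y x) 1 (H x)) (𝔬12 x).blkZ (𝔬12 x).blk ((𝔬12 x).Qstar U) (fun (y y' : (geo9Y x).Site) => ((N : ℝ) ^ 4 * (1 + kCol (θ.d₆ + 1) (θ.ℓ₆ + 1) *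 α₀K * (2 * ((θ.d₆ : ℝ) + 1))) * (((θ.ℓ₆ + 1 : ℕ) : ℝ)) * Real.exp ((δQs + δ12₃) * ((θ.ℓ₆ : ℝ) + 4))) * ((geo9Y x).len y)⁻¹ * (Real.sqrt (((((θ.ℓ₆ + 1 : ℕ) : ℝ) ^ (θ.d₆ + 1)) ^ lvl x.hN x.D x.hk y')⁻¹) * (geo9Y x).len y') * Real.exp (-(δQs * (geo9Y x).dist y y'))) :=
  hqsL2K_knit_of_laws θ Mstar 𝔬12 bI (lawsY_of_eq hbI).2.2.1 H hblk12 hblkZ12 hQsco12 hM12 (le_trans (by positivity) hδQs3) hδ3 (hM12L_of_hM12q θ hM12q)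
    c35Y_eq.le (fun x α₀ U hU => (hRP1 x α₀ U hU).2.1) hαK hαQK (fun x a h0 h => hKplK x.toKIdx a h0 (h.trans ha12K))

omit [NeZero N] in
/-- ★★★ **«KE₂»'s `hqL2K` FROM ITS OWN BINDERS** at the same `BQL` (the `Q`-twin by adjointness): `…ParLawsQL2Knit.hqL2K_knit_of_laws`.
[cite: Balaban1985BackgroundPropagators, Thm 3.13 p.426, (3.13)–(3.16) pp.392–393, (3.115) p.418, (3.35) p.396; Balaban1984PropagatorsII, Lemma 2.1 (2.60) p.234; Balaban1985Averaging, Prop. 2 p.26] -/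
theorem hqL2K_knit_of_pinsR
    {W12 : MemberY θ.d₆ θ.ℓ₆ θ.hd' θ.hL' θ.b₀ θ.b₁ Mstar → Type} [∀ x, Fintype (W12 x)]
    (𝔬12 : ∀ x : MemberY θ.d₆ θ.ℓ₆ θ.hd' θ.hL' θ.b₀ θ.b₁ Mstar, Ops (geo9Y x) (bg9YR (Matrix (Fin N) (Fin N) ℂ) (specialUnitaryUnits (Fin N)) R₁ R₂ x) (XBK (TrIdx N) x.toKIdx) (XBK (TrIdx N) x.toKIdx) (XHK (TrIdx N) x.toKIdx) (W12 x))
    {bI : ∀ x : MemberY θ.d₆ θ.ℓ₆ θ.hd' θ.hL' θ.b₀ θ.b₁ Mstar, FBondY x.toKIdx → IBondY x.toKIdx} (hbI : bI = bIYOfRecord θ Mstar)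
    (H : MemberY θ.d₆ θ.ℓ₆ θ.hd' θ.hL' θ.b₀ θ.b₁ Mstar → Prop)
    (hblk12 : ∀ x : MemberY θ.d₆ θ.ℓ₆ θ.hd' θ.hL' θ.b₀ θ.b₁ Mstar, (𝔬12 x).blk = blkBK x.toKIdx (bI x)) (hblkZ12 : ∀ x : MemberY θ.d₆ θ.ℓ₆ θ.hd' θ.hL' θ.b₀ θ.b₁ Mstar, (𝔬12 x).blkZ = blkHK x.toKIdx)
    (hQco12 : ∀ (x : MemberY θ.d₆ θ.ℓ₆ θ.hd' θ.hL' θ.b₀ θ.b₁ Mstar) (U : (bg9YR (Matrix (Fin N) (Fin N) ℂ) (specialUnitaryUnits (Fin N)) R₁ R₂ x).Cfg),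
      (𝔬12 x).Q U = QcoKHq x.toKIdx (trBasis N) (bg9YR (Matrix (Fin N) (Fin N) ℂ) (specialUnitaryUnits (Fin N)) R₁ R₂ x) (fun U => U) (qKnitOfRecord N θ x.toKIdx) U)
    (hRP1 : ∀ (x : MemberY θ.d₆ θ.ℓ₆ θ.hd' θ.hL' θ.b₀ θ.b₁ Mstar) (α₀ : ℝ) (U : (bg9YR (Matrix (Fin N) (Fin N) ℂ) (specialUnitaryUnits (Fin N)) R₁ R₂ x).Cfg),
      (bg9YR (Matrix (Fin N) (Fin N) ℂ) (specialUnitaryUnits (Fin N)) R₁ R₂ x).Reg335 c α₀ U →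
        0 ≤ α₀ ∧ (bg9YP (Matrix (Fin N) (Fin N) ℂ) (specialUnitaryUnits (Fin N)) x).Reg335 c35Y α₀ U)
    {M12 a12 δ12₃ δQs α₀K aK : ℝ} (hM12 : 0 < M12) (hδ3 : 0 < δ12₃) (hδQs3 : δ12₃ + 1 ≤ δQs)
    (hM12q : (2 : ℝ) * Real.log (((θ.ℓ₆ + 1 : ℕ) : ℝ)) ≤ δ12₃ * (2 * ((θ.ℓ₆ : ℝ) + 1) ^ 2 - 1) * M12)
    (hαK : 0 < α₀K) (hαQK : α₀K ≤ alphaQ (θ.d₆ + 1) (θ.ℓ₆ + 1))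
    (hKplK : ∀ (i : KIdx θ.d₆ θ.ℓ₆ θ.hd' θ.hL' θ.b₀ θ.b₁) (a : ℝ), 0 ≤ a → a ≤ aK → Kpl i a * (kGeo i).L ^ 4 < α₀K) (ha12K : a12 ≤ aK) :
    ∀ x : MemberY θ.d₆ θ.ℓ₆ θ.hd' θ.hL' θ.b₀ θ.b₁ Mstar, M12 ≤ (geo9Y x).M → ∀ α₀ : ℝ, 0 < α₀ → (geo9Y x).M * α₀ ≤ a12 → ∀ U : (bg9YR (Matrix (Fin N) (Fin N) ℂ) (specialUnitaryUnits (Fin N)) R₁ R₂ x).Cfg, (bg9YR (Matrix (Fin N) (Fin N) ℂ) (specialUnitaryUnits (Fin N)) R₁ R₂ x).Reg335 c α₀ U → B9SectDL2Decay.BlockBd (g := toB6 (geo9Y x) 1 (H x)) (𝔬12 x).blk (𝔬12 x).blkZ ((𝔬12 x).Q U) (fun (y y' : (geo9Y x).Site) => ((N : ℝ) ^ 4 * (1 + kCol (θ.d₆ + 1) (θ.ℓ₆ + 1) * α₀K * (2 * ((θ.d₆ : ℝ) + 1))) * (((θ.ℓ₆ + 1 : ℕ) : ℝ)) * Real.exp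 ((δQs + δ12₃) * ((θ.ℓ₆ : ℝ) + 4))) * (Real.sqrt (((((θ.ℓ₆ + 1 : ℕ) : ℝ) ^ (θ.d₆ + 1)) ^ lvl x.hN x.D x.hk y)⁻¹) * (geo9Y x).len y * ((geo9Y x).len y')⁻¹) * Real.exp (-(δQs * (geo9Y x).dist y y'))) :=
  hqL2K_knit_of_laws θ Mstar 𝔬12 bI (lawsY_of_eq hbI).2.2.1 H hblk12 hblkZ12 hQco12 hM12 (le_trans (by positivity) hδQs3) hδ3 (hM12L_of_hM12q θ hM12q)
    c35Y_eq.le (fun x α₀ U hU => (hRP1 x α₀ U hU).2.1) hαK hαQK (fun x a h0 h => hKplK x.toKIdx a h0 (h.trans ha12K))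

/-! ## §5 `hC1TK` at the record residual `resYOfRecordPK`, the guarded `hΔ2` supplied by def-Y's adapter -/

omit [NeZero N] [∀ x : MemberY θ.d₆ θ.ℓ₆ θ.hd' θ.hL' θ.b₀ θ.b₁ Mstar, Fintype (geo9Y x).Site] in
/-- ★★★ **«KE₂»'s `hC1TK` (at `𝔯 := resYOfRecordPK`) FROM ITS OWN BINDERS**: `…ParLawsQG.hC1T_knit_of_pinsG_resK` with the guarded `hΔ2` of the knit residual of record
DISCHARGED by def-Y's ✓ `Node00.hΔ2_knitRecord_of_RP1` (numerics `hαK hαK3 hαK4 hexpK hKplK ha12 ha12K`).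
[cite: Balaban1985BackgroundPropagators, (3.132) p.422, (3.134) p.422, Thm 3.13 p.426, (3.35)–(3.36) p.396; Balaban1985Averaging, Prop. 2 p.26] -/
theorem hC1TK_knitRecord_of_pinsR (hGR : MemOfFam (specialUnitaryUnits (Fin N)) R₁)
    {X12 Y12 W12 : MemberY θ.d₆ θ.ℓ₆ θ.hd' θ.hL' θ.b₀ θ.b₁ Mstar → Type} [∀ x, Fintype (X12 x)] [∀ x, Fintype (Y12 x)] [∀ x, Fintype (W12 x)]
    (𝔬12 : ∀ x : MemberY θ.d₆ θ.ℓ₆ θ.hd' θ.hL' θ.b₀ θ.b₁ Mstar, Ops (geo9Y x) (bg9YR (Matrix (Fin N) (Fin N) ℂ) (specialUnitaryUnits (Fin N)) R₁ R₂ x) (X12 x) (Y12 x) (XHK (TrIdx N) x.toKIdx) (W12 x))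
    (hC1co12 : ∀ (x : MemberY θ.d₆ θ.ℓ₆ θ.hd' θ.hL' θ.b₀ θ.b₁ Mstar) (U : (bg9YR (Matrix (Fin N) (Fin N) ℂ) (specialUnitaryUnits (Fin N)) R₁ R₂ x).Cfg),
      (𝔬12 x).C1 U = C1coKq x.toKIdx (trBasis N) (bg9YR (Matrix (Fin N) (Fin N) ℂ) (specialUnitaryUnits (Fin N)) R₁ R₂ x) (fun U => U)
        (qKnitOfRecord N θ x.toKIdx) (qsKnitOfRecord N θ x.toKIdx) (parKnitY x.toKIdx) (GpPhysY x.toKIdx (parKnitY x.toKIdx)) (resYOfRecordPK N θ Mstar x).Δ2 U)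
    (hRP1 : ∀ (x : MemberY θ.d₆ θ.ℓ₆ θ.hd' θ.hL' θ.b₀ θ.b₁ Mstar) (α₀ : ℝ) (U : (bg9YR (Matrix (Fin N) (Fin N) ℂ) (specialUnitaryUnits (Fin N)) R₁ R₂ x).Cfg),
      (bg9YR (Matrix (Fin N) (Fin N) ℂ) (specialUnitaryUnits (Fin N)) R₁ R₂ x).Reg335 c α₀ U →
        0 ≤ α₀ ∧ (bg9YP (Matrix (Fin N) (Fin N) ℂ) (specialUnitaryUnits (Fin N)) x).Reg335 c35Y α₀ U)
    {M12 a12 α₀K aK : ℝ} (hαK : 0 < α₀K) (hαK3 : C0 (θ.d₆ + 1) * α₀K ≤ 1 / 3) (hαK2 : 2 * α₀K ≤ c2' (θ.d₆ + 1) (θ.ℓ₆ + 1))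
    (hαK4 : 4 * α₀K ≤ c2' (θ.d₆ + 1) (θ.ℓ₆ + 1))
    (hexpK : Real.exp (4 * (800 * (((θ.d₆ + 1 : ℕ) : ℝ) + 1) ^ 2 * (((θ.d₆ + 1 : ℕ) : ℝ) + 4)) * α₀K) < 2)
    (hKplK : ∀ (i : KIdx θ.d₆ θ.ℓ₆ θ.hd' θ.hL' θ.b₀ θ.b₁) (a : ℝ), 0 ≤ a → a ≤ aK → Kpl i a * (kGeo i).L ^ 4 < α₀K) (ha12 : 0 < a12) (ha12K : a12 ≤ aK) :
    ∀ x : MemberY θ.d₆ θ.ℓ₆ θ.hd' θ.hL' θ.b₀ θ.b₁ Mstar, M12 ≤ (geo9Y x).M → ∀ α₀ : ℝ, 0 < α₀ → (geo9Y x).M * α₀ ≤ a12 → ∀ U : (bg9YR (Matrix (Fin N) (Fin N) ℂ) (specialUnitaryUnits (Fin N)) R₁ R₂ x).Cfg, (bg9YR (Matrix (Fin N) (Fin N) ℂ) (specialUnitaryUnits (Fin N)) R₁ R₂ x).Reg335 c α₀ U → (bg9YR (Matrix (Fin N) (Fin N) ℂ) (specialUnitaryUnits (Fin N)) R₁ R₂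 x).Reg336 c α₀ U → IsTransposePair ((𝔬12 x).C1 U) ((𝔬12 x).C1 U) :=
  hC1T_knit_of_pinsG_resK θ Mstar hGR 𝔬12 (resYOfRecordPK N θ Mstar) hC1co12 hRP1 hαK hαK3 hαK2 hKplK ha12K
    (hΔ2_knitRecord_of_RP1 N θ Mstar hRP1 (M12 := M12) hαK hαK3 hαK4 hexpK hKplK ha12.le ha12K)

end Summit.QuantumFields.YangMills.BalabanUVNodes.N06KnitLawsAtRecordKE

end
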